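/-
Origin: expansion seat `planner-pub-hodgecm-qw8-g11-0`, handover #31 SPLIT PART 1/2 of tree `HodgeCM/Model/Toy/LefExamples.lean` 7cb17540 (400 l., RUN-31 install; + 26 owed docstrings > 400-line cap) = NEW module `HodgeCM.Model.Toy.LefCyclotomic` md5 b58199d7d6969d81be94481c268fb8ee (240 l.): verbatim §§1–3 + docstrings; imports: NO rewrite (tree imports only: Mathlib, HodgeCM.Model.Toy.LefNonGenReal); check-wip LANDABLE rc 0 / 0 warnings / 0 proof-hole; lean -Dauto (`HOME/pub-hodgecm-qw8-g11/lean/Qw8g11/LefCyclotomic.lean`, md5 b58199d7, 240 lines);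
landed by the packager successor (mc-unitary-1-g3, gen-8 kit) in gate run 32 as `HodgeCM/Model/Toy/LefCyclotomic.lean` (verbatim).
-/
-- HANDOVER (planner-pub-hodgecm-qw8-g11-0, unit pub-hodgecm-qw8-g11): SPLIT PART 1/2 of the tree file
-- `HodgeCM.Model.Toy.LefExamples` (RUN-31 install, md5 7cb17540, 400 l.; with the 26 owed docstrings it exceeds the 400-line cap) =
-- its §§1–3 (ll. 51–235) verbatim + docstrings; WIP module `Qw8g11.LefCyclotomic`, intended final module
-- `HodgeCM.Model.Toy.LefCyclotomic` (NEW file; tree imports only, NO rewrite).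
/-
Copyright (c) 2026. All rights reserved.
Released under Apache 2.0 license as described in the file LICENSE.
-/
import Mathlib
import Summits.HodgeConjecture.HodgeCM.Model.Toy.LefNonGenReal

/-!
# Cyclotomic CM fields and `PartialConj` decided by roots of unity

Split part 1/2 of `HodgeCM.Model.Toy.LefExamples` (its §§1–3, unchanged): §1 `ℚ(ζₙ) = CyclotomicField n ℚ` (`2 < n`) is a CM
field (Mathlib), normal, of degree `φ(n)`, bundled as `cyc n : CMField` (the numeral facts `Fact (2 < n)` are instances SCOPED
to `HodgeCM.Toy`); `Gal(ℚ(ζ₅)/ℚ)` is cyclic. §2 `NonGenReal ℚ(ζ₅)`, `NonGenReal ℚ(ζ₃)`, `NonGenReal ℚ(ζ₄)`, `ClosureExclusive ℚ(ζ₅)`.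
§3 `PartialConj` decided by roots of unity: `liftK_not_mem_galClosure_of_isPrimitiveRoot` (if `K₁` is normal with a primitive
`n`-th root of unity, `y ∈ K₂` is a primitive `m`-th root and `φ(lcm n m) > [K₁:ℚ]`, no embedding of `K₂` maps `y` into
`galClosure K₁`), hence `PartialConj ℚ(ζₙ) ℚ(ζₘ)` for the listed pairs. The negative instances and the decided model headlines
are in `HodgeCM.Model.Toy.LefExamples`, whose module docstring describes the whole. Kernel-checked from Mathlib; nothing cited.
-/

noncomputable section
set_option backward.isDefEq.respectTransparency false
namespace HodgeCM.Toy

open Literature.AlgebraicGeometry.Motives (CMType)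
open NumberField.ComplexEmbedding (conjugate)
open IsCyclotomicExtension (zeta zeta_spec)
open Polynomial (cyclotomic)

/-! ### 1. Cyclotomic CM fields -/

section Cyclotomic

/-- `ℚ(ζₙ)` is a CM field for `2 < n` (a nontrivial cyclotomic extension of `ℚ` is totally complex abelian) -/
instance isCMField_cyclotomicField (n : ℕ) [hn : Fact (2 < n)] : NumberField.IsCMField (CyclotomicField n ℚ) :=
  IsCyclotomicExtension.Rat.isCMField _ ⟨n, Set.mem_singleton n, hn.out⟩

/-- `ℚ(ζₙ)/ℚ` is Galois -/
instance isGalois_cyclotomicField (n : ℕ) : IsGalois ℚ (CyclotomicField n ℚ) :=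
  IsCyclotomicExtension.isGalois {n} ℚ _

/-- `[ℚ(ζₙ) : ℚ] = φ(n)` -/
theorem finrank_cyclotomicField (n : ℕ) [NeZero n] :
    Module.finrank ℚ (CyclotomicField n ℚ) = n.totient :=
  IsCyclotomicExtension.finrank _ (Polynomial.cyclotomic.irreducible_rat (NeZero.pos n))

/-! the numerals `n` used below, as `Fact (2 < n)` instances SCOPED to `HodgeCM.Toy` (needed by `cyc n`) -/
/-- (Ported verbatim from the HodgeCMPerL package; no docstring in the source.) -/
scoped instance fact_two_lt_three : Fact (2 < 3) := ⟨by norm_num⟩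
/-- (Ported verbatim from the HodgeCMPerL package; no docstring in the source.) -/
scoped instance fact_two_lt_four : Fact (2 < 4) := ⟨by norm_num⟩
/-- (Ported verbatim from the HodgeCMPerL package; no docstring in the source.) -/
scoped instance fact_two_lt_five : Fact (2 < 5) := ⟨by norm_num⟩
/-- (Ported verbatim from the HodgeCMPerL package; no docstring in the source.) -/
scoped instance fact_two_lt_seven : Fact (2 < 7) := ⟨by norm_num⟩
/-- (Ported verbatim from the HodgeCMPerL package; no docstring in the source.) -/
scoped instance fact_two_lt_eight : Fact (2 < 8) := ⟨by norm_num⟩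
/-- (Ported verbatim from the HodgeCMPerL package; no docstring in the source.) -/
scoped instance fact_two_lt_twelve : Fact (2 < 12) := ⟨by norm_num⟩

/-- the cyclotomic CM field `ℚ(ζₙ)`, bundled -/
abbrev cyc (n : ℕ) [Fact (2 < n)] : CMField := ⟨CyclotomicField n ℚ⟩

/-- `[ℚ(ζ₃) : ℚ] = 2` -/
theorem finrank_cyc3 : Module.finrank ℚ (CyclotomicField 3 ℚ) = 2 := by
  rw [finrank_cyclotomicField]; decide
/-- `[ℚ(ζ₄) : ℚ] = 2` -/
theorem finrank_cyc4 : Module.finrank ℚ (CyclotomicField 4 ℚ) = 2 := by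
  rw [finrank_cyclotomicField]; decide
/-- `[ℚ(ζ₅) : ℚ] = 4` -/
theorem finrank_cyc5 : Module.finrank ℚ (CyclotomicField 5 ℚ) = 4 := by
  rw [finrank_cyclotomicField]; decide
/-- `[ℚ(ζ₇) : ℚ] = 6` -/
theorem finrank_cyc7 : Module.finrank ℚ (CyclotomicField 7 ℚ) = 6 := by
  rw [finrank_cyclotomicField]; decide
/-- `[ℚ(ζ₈) : ℚ] = 4` -/
theorem finrank_cyc8 : Module.finrank ℚ (CyclotomicField 8 ℚ) = 4 := by
  rw [finrank_cyclotomicField]; decide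
/-- `[ℚ(ζ₁₂) : ℚ] = 4` -/
theorem finrank_cyc12 : Module.finrank ℚ (CyclotomicField 12 ℚ) = 4 := by
  rw [finrank_cyclotomicField]; decide

/-- `Gal(ℚ(ζ₅)/ℚ) ≅ (ℤ/5)ˣ` is cyclic -/
instance isCyclic_gal_cyc5 : IsCyclic (CyclotomicField 5 ℚ ≃ₐ[ℚ] CyclotomicField 5 ℚ) :=
  (IsCyclotomicExtension.autEquivPow (CyclotomicField 5 ℚ)
    (Polynomial.cyclotomic.irreducible_rat (by norm_num : 0 < 5))).isCyclic.mpr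
    (ZMod.isCyclic_units_prime (by norm_num : Nat.Prime 5))

end Cyclotomic

/-! ### 2. `NonGenReal` instances -/

section NonGen

/-- `ℚ(ζ₅)`, the cyclic quartic CM field of conductor `5`, has `NonGenReal` -/
theorem nonGenReal_cyc5 : NonGenReal (CyclotomicField 5 ℚ) :=
  nonGenReal_of_isCyclic (k := 2) (by rw [finrank_cyc5]; norm_num)

/-- `NonGenReal ℚ(ζ₃)` (imaginary quadratic) -/
theorem nonGenReal_cyc3 : NonGenReal (CyclotomicField 3 ℚ) :=
  nonGenReal_of_finrank_eq_two _ finrank_cyc3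

/-- `NonGenReal ℚ(ζ₄) = NonGenReal ℚ(i)` (imaginary quadratic) -/
theorem nonGenReal_cyc4 : NonGenReal (CyclotomicField 4 ℚ) :=
  nonGenReal_of_finrank_eq_two _ finrank_cyc4

/-- and is closure-exclusive -/
theorem closureExclusive_cyc5 : ClosureExclusive (CyclotomicField 5 ℚ) :=
  closureExclusive_of_normal _ nonGenReal_cyc5

end NonGen

/-! ### 3. `PartialConj` decided by roots of unity -/

section Roots

variable {K₁ K₂ : Type} [Field K₁] [NumberField K₁] [Field K₂] [NumberField K₂]

/-- **Roots of unity detect non-embedding.** `K₁` normal containing a primitive `n`-th root of unity, `y ∈ K₂` a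
primitive `m`-th root of unity, `φ(lcm n m) > [K₁ : ℚ]`: no embedding of `K₂` maps `y` into the Galois closure of
`K₁` (which is the image of `K₁`, of degree `[K₁ : ℚ]`, and would contain a primitive `lcm n m`-th root of unity). -/
theorem liftK_not_mem_galClosure_of_isPrimitiveRoot [Normal ℚ K₁] {n m : ℕ} {x : K₁} {y : K₂}
    (hx : IsPrimitiveRoot x n) (hy : IsPrimitiveRoot y m) (hn : 0 < n) (hm : 0 < m)
    (h : Module.finrank ℚ K₁ < (Nat.lcm n m).totient) (b : K₂ →+* ℂ) :
    liftK b y ∉ galClosure K₁ := by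
  intro hmem
  obtain ⟨a⟩ := (inferInstance : Nonempty (K₁ →+* ℂ))
  have hxL : IsPrimitiveRoot (equivGalClosure K₁ a x) n :=
    hx.map_of_injective (equivGalClosure K₁ a).injective
  have hyQ : IsPrimitiveRoot (liftK b y) m := hy.map_of_injective (liftK b).injective
  have hyL : IsPrimitiveRoot (⟨liftK b y, hmem⟩ : ↥(galClosure K₁)) m :=
    IsPrimitiveRoot.coe_submonoidClass_iff.mp hyQ
  have key := hxL.lcm_totient_le_finrank hyL (Polynomial.cyclotomic.irreducible_rat (Nat.lcm_pos hn hm))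
  rw [finrank_galClosure] at key
  omega

/-- hence `K₂` does not embed into the Galois closure of `K₁` -/
theorem not_galClosure_le_of_isPrimitiveRoot [Normal ℚ K₁] {n m : ℕ} {x : K₁} {y : K₂}
    (hx : IsPrimitiveRoot x n) (hy : IsPrimitiveRoot y m) (hn : 0 < n) (hm : 0 < m)
    (h : Module.finrank ℚ K₁ < (Nat.lcm n m).totient) : ¬ galClosure K₂ ≤ galClosure K₁ := by
  obtain ⟨b⟩ := (inferInstance : Nonempty (K₂ →+* ℂ))
  exact fun hle => liftK_not_mem_galClosure_of_isPrimitiveRoot hx hy hn hm h b (galClosure_le_iff.mp hle b y)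

/-- **normal `NonGenReal` partner with a root of unity of too large an order: a partial conjugation exists** -/
theorem partialConj_of_isPrimitiveRoot [Normal ℚ K₁] [Normal ℚ K₂] (hK₂ : NonGenReal K₂) {n m : ℕ} {x : K₁}
    {y : K₂} (hx : IsPrimitiveRoot x n) (hy : IsPrimitiveRoot y m) (hn : 0 < n) (hm : 0 < m)
    (h : Module.finrank ℚ K₁ < (Nat.lcm n m).totient) : PartialConj K₁ K₂ :=
  partialConj_of_normal hK₂ (not_galClosure_le_of_isPrimitiveRoot hx hy hn hm h)

/-- a primitive `k`-th root of unity in `ℂ`, `2 < k`, is not real -/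
theorem conj_ne_of_isPrimitiveRoot {z : ℂ} {k : ℕ} (hz : IsPrimitiveRoot z k) (hk : 2 < k) :
    starRingEnd ℂ z ≠ z := by
  intro h
  obtain ⟨r, rfl⟩ := Complex.conj_eq_iff_real.mp h
  have h3 : |r| = 1 := by
    rw [← Real.norm_eq_abs, ← Complex.norm_real]
    exact hz.norm'_eq_one (by omega)
  have h4 : (r : ℂ) ^ 2 = 1 := by
    rcases (abs_eq zero_le_one).mp h3 with rfl | rfl
    · norm_num
    · push_cast; norm_num
  have h5 : k ∣ 2 := hz.dvd_of_pow_eq_one 2 h4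
  exact absurd (Nat.le_of_dvd (by norm_num) h5) (by omega)

/-- **A shared root of unity of order `> 2` forbids mixing with a normal field.** `K₁` normal containing a
primitive `k`-th root of unity, `K₂` containing one, `2 < k`: every embedding `b` of `K₂` takes the non-real value
`b y` inside `galClosure K₁` (the primitive `k`-th roots of unity of `ℚ̄` are the powers of any one of them); no
partial conjugation. Instances: `ℚ(ζ₈)`/`ℚ(ζ₁₂)`, `ℚ(ζ₈)`/`ℚ(i)`, `ℚ(ζ₁₂)`/`ℚ(i)` (`k = 4`), `ℚ(ζ₁₂)`/`ℚ(ζ₃)`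
(`k = 3`). -/
theorem not_partialConj_of_isPrimitiveRoot [Normal ℚ K₁] {k : ℕ} {x : K₁} {y : K₂} (hx : IsPrimitiveRoot x k)
    (hy : IsPrimitiveRoot y k) (hk : 2 < k) : ¬ PartialConj K₁ K₂ := by
  haveI : NeZero k := ⟨by omega⟩
  obtain ⟨a⟩ := (inferInstance : Nonempty (K₁ →+* ℂ))
  obtain ⟨b⟩ := (inferInstance : Nonempty (K₂ →+* ℂ))
  refine not_partialConj_of_mem_galClosure b y ?_
    (conj_ne_of_isPrimitiveRoot (hy.map_of_injective b.injective) hk)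
  have hxQ : IsPrimitiveRoot (liftK a x) k := hx.map_of_injective (liftK a).injective
  have hyQ : IsPrimitiveRoot (liftK b y) k := hy.map_of_injective (liftK b).injective
  obtain ⟨i, -, hi⟩ := hxQ.eq_pow_of_pow_eq_one hyQ.pow_eq_one
  rw [galClosure_eq_fieldRange K₁ a, ← hi]
  exact pow_mem ((liftA K₁ a).mem_fieldRange.mpr ⟨x, rfl⟩) i

/-! #### cyclotomic instances -/

/-- `ℚ(ζₘ)` does not embed into `ℚ(ζₙ)` when `φ(lcm n m) > φ(n)` -/
theorem not_galClosure_cyc_le {n m : ℕ} [NeZero n] [NeZero m] (h : n.totient < (Nat.lcm n m).totient) :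
    ¬ galClosure (CyclotomicField m ℚ) ≤ galClosure (CyclotomicField n ℚ) :=
  not_galClosure_le_of_isPrimitiveRoot (zeta_spec n ℚ _) (zeta_spec m ℚ _) (NeZero.pos n) (NeZero.pos m)
    (by rwa [finrank_cyclotomicField])

/-- hence the closures differ -/
theorem galClosure_cyc_ne {n m : ℕ} [NeZero n] [NeZero m] (h : n.totient < (Nat.lcm n m).totient) :
    galClosure (CyclotomicField n ℚ) ≠ galClosure (CyclotomicField m ℚ) := fun he =>
  not_galClosure_cyc_le h he.ge

/-- `ℚ(ζₙ)` mixes with a `NonGenReal` cyclotomic partner `ℚ(ζₘ)` as soon as `φ(lcm n m) > φ(n)` -/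
theorem partialConj_cyc_of_nonGenReal {n m : ℕ} [NeZero n] [NeZero m] (hm : NonGenReal (CyclotomicField m ℚ))
    (h : n.totient < (Nat.lcm n m).totient) : PartialConj (CyclotomicField n ℚ) (CyclotomicField m ℚ) :=
  partialConj_of_normal hm (not_galClosure_cyc_le h)

/-- `PartialConj ℚ(ζ₅) ℚ(ζ₃)` -/
theorem partialConj_cyc5_cyc3 : PartialConj (CyclotomicField 5 ℚ) (CyclotomicField 3 ℚ) :=
  partialConj_cyc_of_nonGenReal nonGenReal_cyc3 (by decide)
/-- `PartialConj ℚ(ζ₅) ℚ(ζ₄)` -/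
theorem partialConj_cyc5_cyc4 : PartialConj (CyclotomicField 5 ℚ) (CyclotomicField 4 ℚ) :=
  partialConj_cyc_of_nonGenReal nonGenReal_cyc4 (by decide)
/-- `PartialConj ℚ(ζ₃) ℚ(ζ₄)` -/
theorem partialConj_cyc3_cyc4 : PartialConj (CyclotomicField 3 ℚ) (CyclotomicField 4 ℚ) :=
  partialConj_cyc_of_nonGenReal nonGenReal_cyc4 (by decide)
/-- `PartialConj ℚ(ζ₃) ℚ(ζ₅)` -/
theorem partialConj_cyc3_cyc5 : PartialConj (CyclotomicField 3 ℚ) (CyclotomicField 5 ℚ) :=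
  partialConj_cyc_of_nonGenReal nonGenReal_cyc5 (by decide)
/-- `PartialConj ℚ(ζ₄) ℚ(ζ₅)` -/
theorem partialConj_cyc4_cyc5 : PartialConj (CyclotomicField 4 ℚ) (CyclotomicField 5 ℚ) :=
  partialConj_cyc_of_nonGenReal nonGenReal_cyc5 (by decide)
/-- biquadratic `ℚ(ζ₈)` (which fails `NonGenReal` and `ClosureExclusive`) against the cyclic quartic `ℚ(ζ₅)` -/
theorem partialConj_cyc8_cyc5 : PartialConj (CyclotomicField 8 ℚ) (CyclotomicField 5 ℚ) :=
  partialConj_cyc_of_nonGenReal nonGenReal_cyc5 (by decide)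
/-- `PartialConj ℚ(ζ₁₂) ℚ(ζ₅)` (biquadratic first field) -/
theorem partialConj_cyc12_cyc5 : PartialConj (CyclotomicField 12 ℚ) (CyclotomicField 5 ℚ) :=
  partialConj_cyc_of_nonGenReal nonGenReal_cyc5 (by decide)
/-- `PartialConj ℚ(ζ₈) ℚ(ζ₃)` (biquadratic first field) -/
theorem partialConj_cyc8_cyc3 : PartialConj (CyclotomicField 8 ℚ) (CyclotomicField 3 ℚ) :=
  partialConj_cyc_of_nonGenReal nonGenReal_cyc3 (by decide)
/-- `PartialConj ℚ(ζ₅) ℚ(ζ₁₂)` -/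
theorem partialConj_cyc5_cyc12 : PartialConj (CyclotomicField 5 ℚ) (CyclotomicField 12 ℚ) :=
  partialConj_cyc12_cyc5.symm
/-- `PartialConj ℚ(ζ₅) ℚ(ζ₈)` -/
theorem partialConj_cyc5_cyc8 : PartialConj (CyclotomicField 5 ℚ) (CyclotomicField 8 ℚ) :=
  partialConj_cyc8_cyc5.symm
/-- the sextic `ℚ(ζ₇)` (outside the model's range `[K:ℚ] ≤ 4`, but the field statement stands) -/
theorem partialConj_cyc7_cyc5 : PartialConj (CyclotomicField 7 ℚ) (CyclotomicField 5 ℚ) :=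
  partialConj_cyc_of_nonGenReal nonGenReal_cyc5 (by decide)
/-- `PartialConj ℚ(ζ₇) ℚ(ζ₃)` (first field of degree `6`) -/
theorem partialConj_cyc7_cyc3 : PartialConj (CyclotomicField 7 ℚ) (CyclotomicField 3 ℚ) :=
  partialConj_cyc_of_nonGenReal nonGenReal_cyc3 (by decide)
/-- `PartialConj ℚ(ζ₇) ℚ(ζ₄)` (first field of degree `6`) -/
theorem partialConj_cyc7_cyc4 : PartialConj (CyclotomicField 7 ℚ) (CyclotomicField 4 ℚ) :=
  partialConj_cyc_of_nonGenReal nonGenReal_cyc4 (by decide)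

end Roots

end HodgeCM.Toy
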